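import Summits.Ventures.CertifiedManyBodySolver.Observables.PhaseSeparationExclusionBoxZeemanFreeDilute
import HarnessLib

/-!
# Ventures/CertifiedManyBodySolver — Observables/PhaseSeparationExclusionBoxZeemanTcap.lean: the FIELD (H-axis) competing-order cell forms with a
# `t′`-AFFINE CAP `c₀ + c_s·s + c₁·U` — `T = 0` field ground states and `T > 0` canonical field equilibria, column (× threshold) forms

HONEST FRAMING: a transport device; the `c_s ≠ 0` editions of `psH_not_fieldGroundState_mix_on_cell_of_columns` (g21) and
`psHT_not_fieldEquilibrium_mix_on_cell_of_columns_hotAnchorSS` (g25): at fixed `s` the cap `c₀ + c_s s + c₁ U` is the `U`-affine cap `(c₀ + c_s s) + c₁ U`, so the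
zero-`c_s` algebra (`uchord_pos_of_ends`, `hotAnchor_chord_slack`) applies verbatim with `c₀ ↦ c₀ + c_s s`. Laws (this seat, g21):
`IsTranslationInvariant.fieldGroundEnergy_lt_meanEnergy_mix_of_cap_lt_floors_of_abs_le` (`T = 0`) and
`IsTranslationInvariant.sub_mul_field_lt_pressureTT'Zeeman_mix_of_hotAnchors_of_threshold_of_abs_le` (`T > 0`), `Literature/…/HubbardTTPrimePhaseCoexistenceExclusionZeeman.lean`:
ZERO-FIELD cap / floors / anchors with margin `M` exclude the `(≤ n₁ | ≥ n₂)` coexistence (`n₂ ≤ 1`) in the uniform Zeeman field for every `|h| ≤ h₀` once the margin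
survives the field cost `h₀·(a n₁ + b n₂)`. Needed by the MID-SEGMENT-CAP words (this seat g26), whose cap is the registry's `t′`-affine filling-`1/2` witness plane r468.
CONTROL class; Zeeman coupling only (no orbital field); conditional on whatever nodes an instance names; nothing about SC or `T_c`; no number of record. Zero kit, no
definition, no claim node.

Cell `pub/hubbard-downfold` (MO-S1 filling lane; D-0098 `H` axis), seat `hubbard-downfold-unc-2` (g26), 2026-08-29.
References: R. B. Israel (1979) Thm I.2.4 [Israel1979]; E. H. Lieb, PRL 62 (1989) 1201 [LiebPRL1989]; R. B. Griffiths, J. Math. Phys. 5 (1964) 1215 [Griffiths1964];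
D. Poulin, M. B. Hastings, PRL 106 (2011) 080403 [PoulinHastings2011].
-/

noncomputable section

namespace Summit.Ventures.CertifiedManyBodySolver.Observables

open Literature.MathematicalPhysics.QuantumLattice Literature.MathematicalPhysics.QuantumLattice.ThermodynamicLimit
open Literature.MathematicalPhysics.QuantumLattice.InfVolFermionState Set Filter

/-! ## §1 `T = 0`: field ground states on a cell, `t′`-affine cap -/

/-- **FIELD PS EXCLUSION ON A CELL, `T = 0`, COLUMN FORM, CAP AFFINE IN `(s, U)`.** As `psH_not_fieldGroundState_mix_on_cell_of_columns` with the cap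
`e(t,s,U,a n₁ + b n₂) ≤ c₀ + c_s s + c₁ U` and the column margins after the field cost `c₀ + c_s s + c₁U_i + h₀·(an₁ + bn₂) < aF₁(s) + bL_i(s)`: for every
`|h| ≤ h₀` and every `(s, U)` of the cell no `(≤ n₁ | ≥ n₂)` mixture (`n₂ ≤ 1`) of translation-invariant states is a ground state of `Φ(t,s,U) − h·(n↑−n↓)` at its
filling. [cite: Israel1979, Thm. I.2.4] [cite: Griffiths1964, Appendix] [cite: EmeryKivelsonLin1990, pp. 475–476] -/
theorem psH_not_fieldGroundState_mix_on_cell_of_columns_tcap (t : ℝ) {s₁ s₂ U₁ U₂ n₁ n₂ a b c₀ cs c₁ h₀ hz : ℝ} (hU₁ : 0 ≤ U₁)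
    (h12 : U₁ < U₂) (hn₁ : 0 ≤ n₁) (hn : n₁ < n₂) (hn₂ : n₂ ≤ 1) (ha : 0 ≤ a) (hb : 0 ≤ b) (hab : a + b = 1)
    {L₁ L₂ F₁ : ℝ → ℝ}
    (hC : ∀ s ∈ Icc s₁ s₂, ∀ U ∈ Icc U₁ U₂, energyDensityTT' t s U (a * n₁ + b * n₂) ≤ c₀ + cs * s + c₁ * U)
    (hL₁ : ∀ s ∈ Icc s₁ s₂, L₁ s ≤ energyDensityTT' t s U₁ n₂) (hL₂ : ∀ s ∈ Icc s₁ s₂, L₂ s ≤ energyDensityTT' t s U₂ n₂)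
    (hF₁ : ∀ s ∈ Icc s₁ s₂, ∀ U ∈ Icc U₁ U₂, F₁ s ≤ energyDensityTT' t s U n₁)
    (hh : |hz| ≤ h₀)
    (hm₁ : ∀ s ∈ Icc s₁ s₂, c₀ + cs * s + c₁ * U₁ + h₀ * (a * n₁ + b * n₂) < a * F₁ s + b * L₁ s)
    (hm₂ : ∀ s ∈ Icc s₁ s₂, c₀ + cs * s + c₁ * U₂ + h₀ * (a * n₁ + b * n₂) < a * F₁ s + b * L₂ s)
    {s : ℝ} (hs : s ∈ Icc s₁ s₂) {U : ℝ} (hU : U ∈ Icc U₁ U₂)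
    {ω₁ ω₂ : InfVolFermionState 2} (h₁ : ω₁.IsTranslationInvariant) (h₂ : ω₂.IsTranslationInvariant)
    (hρ₁ : 0 < ω₁.density) (hρ₁' : ω₁.density ≤ n₁) (hρ₂ : n₂ ≤ ω₂.density) (hρ₂' : ω₂.density < 2)
    {lam : ℝ} (hl0 : 0 < lam) (hl1 : lam < 1) :
    (gcInteractionTT' t s U 0 hz).tiGroundEnergyDensityAt 1 (mix lam hl0.le hl1.le ω₁ ω₂).density <
      (mix lam hl0.le hl1.le ω₁ ω₂).meanEnergy (gcInteractionTT' t s U 0 hz) 1 := by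
  have hn2' : 0 ≤ n₂ := hn₁.trans hn.le
  have hn₂2 : n₂ < 2 := by linarith
  have hF₂ := floor_on_cell_of_columnLaws t hn2' hn₂2 hU₁ h12 hL₁ hL₂ s hs U hU
  refine h₁.fieldGroundEnergy_lt_meanEnergy_mix_of_cap_lt_floors_of_abs_le t s (hU₁.trans hU.1) hz h₂ hρ₁ hρ₂' hρ₁' hn hρ₂
    hn₂ ha hb hab (hC s hs U hU) (hF₁ s hs U hU) hF₂ hh ?_ hl0 hl1
  have hpos := uchord_pos_of_ends h12 hU (sub_pos.2 (hm₁ s hs)) (sub_pos.2 (hm₂ s hs))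
  have hd : (U₂ - U₁) ≠ 0 := (sub_pos.2 h12).ne'
  have hid : a * F₁ s + b * (((U₂ - U) * L₁ s + (U - U₁) * L₂ s) / (U₂ - U₁)) - (c₀ + cs * s + c₁ * U + h₀ * (a * n₁ + b * n₂)) =
      ((U₂ - U) * (a * F₁ s + b * L₁ s - (c₀ + cs * s + c₁ * U₁ + h₀ * (a * n₁ + b * n₂))) +
        (U - U₁) * (a * F₁ s + b * L₂ s - (c₀ + cs * s + c₁ * U₂ + h₀ * (a * n₁ + b * n₂)))) / (U₂ - U₁) := by
    field_simp
    ring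
  have h := hid ▸ hpos
  linarith

/-! ## §2 `T > 0`: canonical field equilibria on a cell, column × threshold form, `s`-dependent anchors, `t′`-affine cap -/

/-- **FIELD THERMAL PS EXCLUSION, COLUMN × THRESHOLD FORM, CAP AFFINE IN `(s, U)`, `s`-DEPENDENT ANCHORS `Q₁(s)`, `Q₂(s)`** (as
`psHT_not_fieldEquilibrium_mix_on_cell_of_columns_hotAnchorSS` with the cap `c₀ + c_s s + c₁ U`): for every `|h| ≤ h₀` and every `(s, U)` of `[s₁, s₂] × [U₁, U₂]`,
no mixture of translation-invariant states with densities `0 < ρ(ω₁) ≤ n₁`, `n₂ ≤ ρ(ω₂) < 2` (`n₂ ≤ 1`) is a canonical equilibrium state of `Φ(t,s,U) − h(n↑ − n↓)`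
at any `β ≥ β₀`. [cite: Israel1979, Thm. I.2.4] [cite: LiebPRL1989, proof of Theorem 1] [cite: PoulinHastings2011, eqs. (3)–(8)] -/
theorem psHT_not_fieldEquilibrium_mix_on_cell_of_columns_hotAnchorSS_tcap (t : ℝ)
    {s₁ s₂ U₁ U₂ n₁ n₂ a b c₀ cs c₁ β β₀ βh₁ βh₂ h₀ hz : ℝ}
    (hU₁ : 0 ≤ U₁) (h12 : U₁ < U₂) (hn₁ : 0 ≤ n₁) (hn : n₁ < n₂) (hn₂ : n₂ ≤ 1) (ha : 0 ≤ a) (hb : 0 ≤ b)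
    (hab : a + b = 1) (hβh₁ : 0 ≤ βh₁) (hβh₂ : 0 ≤ βh₂) (h0₁ : βh₁ ≤ β₀) (h0₂ : βh₂ ≤ β₀) (hβ₀ : β₀ ≤ β)
    (hβ₀pos : 0 < β₀) {L₁ L₂ F₁ Q₁ Q₂ : ℝ → ℝ}
    (hC : ∀ s ∈ Icc s₁ s₂, ∀ U ∈ Icc U₁ U₂, energyDensityTT' t s U (a * n₁ + b * n₂) ≤ c₀ + cs * s + c₁ * U)
    (hL₁ : ∀ s ∈ Icc s₁ s₂, L₁ s ≤ energyDensityTT' t s U₁ n₂) (hL₂ : ∀ s ∈ Icc s₁ s₂, L₂ s ≤ energyDensityTT' t s U₂ n₂)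
    (hF₁ : ∀ s ∈ Icc s₁ s₂, ∀ U ∈ Icc U₁ U₂, F₁ s ≤ energyDensityTT' t s U n₁)
    (hπ₁ : ∀ s ∈ Icc s₁ s₂, ∀ U ∈ Icc U₁ U₂, pressureTT' βh₁ t s U n₁ ≤ Q₁ s)
    (hπ₂ : ∀ s ∈ Icc s₁ s₂, ∀ U ∈ Icc U₁ U₂, pressureTT' βh₂ t s U n₂ ≤ Q₂ s)
    (hh : |hz| ≤ h₀)
    (hm₁ : ∀ s ∈ Icc s₁ s₂, 0 ≤ a * F₁ s + b * L₁ s - (c₀ + cs * s + c₁ * U₁) - h₀ * (a * n₁ + b * n₂))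
    (hm₂ : ∀ s ∈ Icc s₁ s₂, 0 ≤ a * F₁ s + b * L₂ s - (c₀ + cs * s + c₁ * U₂) - h₀ * (a * n₁ + b * n₂))
    (hg₁ : ∀ s ∈ Icc s₁ s₂, a * Q₁ s + b * Q₂ s + βh₁ * (a * F₁ s) + βh₂ * (b * L₁ s) <
      β₀ * (a * F₁ s + b * L₁ s - (c₀ + cs * s + c₁ * U₁) - h₀ * (a * n₁ + b * n₂)))
    (hg₂ : ∀ s ∈ Icc s₁ s₂, a * Q₁ s + b * Q₂ s + βh₁ * (a * F₁ s) + βh₂ * (b * L₂ s) <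
      β₀ * (a * F₁ s + b * L₂ s - (c₀ + cs * s + c₁ * U₂) - h₀ * (a * n₁ + b * n₂)))
    {s : ℝ} (hs : s ∈ Icc s₁ s₂) {U : ℝ} (hU : U ∈ Icc U₁ U₂)
    {ω₁ ω₂ : InfVolFermionState 2} (h₁ : ω₁.IsTranslationInvariant) (h₂ : ω₂.IsTranslationInvariant)
    (hρ₁ : 0 < ω₁.density) (hρ₁' : ω₁.density ≤ n₁) (hρ₂ : n₂ ≤ ω₂.density) (hρ₂' : ω₂.density < 2)
    {lam : ℝ} (hl0 : 0 < lam) (hl1 : lam < 1) :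
    (mix lam hl0.le hl1.le ω₁ ω₂).entropyDensitySup -
        β * (mix lam hl0.le hl1.le ω₁ ω₂).meanEnergy (gcInteractionTT' t s U 0 hz) 1 <
      pressureTT'Zeeman β t s U (mix lam hl0.le hl1.le ω₁ ω₂).density hz := by
  have hn2' : 0 ≤ n₂ := hn₁.trans hn.le
  have hn₂2 : n₂ < 2 := by linarith
  have hβpos : 0 < β := hβ₀pos.trans_le hβ₀
  have hF₂ := floor_on_cell_of_columnLaws t hn2' hn₂2 hU₁ h12 hL₁ hL₂ s hs U hU
  obtain ⟨hMnn, hM₀⟩ := hotAnchor_chord_slack (c₀ := c₀ + cs * s) (βh₁ := βh₁) (βh₂ := βh₂) (π₁ := Q₁ s) (π₂ := Q₂ s) h12 hU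
    (hm₁ s hs) (hm₂ s hs) (hg₁ s hs) (hg₂ s hs)
  exact h₁.sub_mul_field_lt_pressureTT'Zeeman_mix_of_hotAnchors_of_threshold_of_abs_le t s (hU₁.trans hU.1) hβpos hz h₂ hρ₁
    hρ₂' hρ₁' hn hρ₂ hn₂ ha hb hab (hC s hs U hU) (hF₁ s hs U hU) hF₂ hβh₁ hβh₂ h0₁ h0₂ hβ₀ (hπ₁ s hs U hU) (hπ₂ s hs U hU)
    hh hMnn hM₀ hl0 hl1

end Summit.Ventures.CertifiedManyBodySolver.Observables

end
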